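import Summits.BirchSwinnertonDyer.BirchSwinnertonDyer.Theorems.PrintX10bHowardSettingSatisfiesH
import Literature.NumberTheory.EllipticCurves.ZpExtensionEisensteinDVRSettingH5bLevelLiftProofs
import Literature.NumberTheory.EllipticCurves.ZpExtensionEisensteinDVRSettingH5bBadPlacesUniformProofs
import Literature.NumberTheory.EllipticCurves.ZpExtensionEisensteinBadPlacesLocalTorsionProofs
import Literature.NumberTheory.EllipticCurves.ZpExtensionEisensteinDVRSettingDualityDataProofs
import Literature.NumberTheory.EllipticCurves.ZpExtensionEisensteinDVRSettingLevelsTame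
import Summits.BirchSwinnertonDyer.BirchSwinnertonDyer.Theorems.UniversalToricDescentTwinH5bAtSZeroThree
import HarnessLib

/-!
# H.5(b) at EVERY tower level and EVERY place of `S` on the twin frame (MULTIPLICATIVE reduction above `3`) — x10b's letter
# `Stmt.h5bAtS` at `p = 3` for the twin of crux 24737 (helper, THEOREMS ONLY: no definition, no named fact, no instance, no `sorry`)

Helper toward the registered stub `stub_howardOutputsOfFamily` (K2) of line `beta-road` (skeleton v10 cd44fe9d5c6b9a78) of crux r205
stmt-BirchSwinnertonDyer-24737 `…Theses.UniversalToricDescent.TwinAlgMuZeroAtThree` (LEAD lineage `bsd-wall-utd-p1`, g25): the fifth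
SUMMITS-side brick of the twin's E2 (H-twin) assembly — the `hfin5b` clause of
`UniversalToricDescentTwinHowardSettingSatisfiesH.exists_eisensteinSettingData_satisfiesH_eRed_of_hasSurjectiveModNGaloisRep{,_unconditional}`
on the twin frame.  x10b-p1-w8's `HeegnerMuPartH5bAtS.h5bAtS_of_clauseZeroP` (`Theorems/PrintX9MuPartStubH5bAtSOfClauseZero`: all levels
from level `0` by `eisensteinDVRSetting_h5b_hfin_of_zero`; the places prime to `p` by the uniform A4 clause) uses only the basic frame
facts; on the TWIN frame the level-`0` clause above `3` is `UniversalToricDescentTwinH5bAtSZeroThree.h5bAtSZeroThree_of_hasMultiplicativeReductionAt`.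
Bookkeeping toward one stub of one crux; no summit statement is proved; BSD is not proved by any of this.
-/

set_option linter.dupNamespace false
set_option autoImplicit false

noncomputable section

open scoped Classical Pointwise ContRepresentation TensorProduct NumberField

open Function NumberField IsDedekindDomain Field
open Literature Literature.NumberTheory.EllipticCurves WeierstrassCurve
open Literature.NumberTheory.GaloisCohomology Literature.NumberTheory.GaloisCohomology.Howard2004
open Literature.NumberTheory.Automorphic
open Literature.NumberTheory.GaloisRepresentations Literature.NumberTheory.GaloisRepresentations.DiscreteGaloisModule
open Summit.BirchSwinnertonDyer.BirchSwinnertonDyer.Theorems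

namespace Summit.BirchSwinnertonDyer.BirchSwinnertonDyer.Theorems.UniversalToricDescentTwinH5bAtSThree

set_option synthInstance.maxHeartbeats 80000 in
set_option maxHeartbeats 1600000 in
/-- **H.5(b) for the curve's levels-tame Eisenstein setting at every tower level `k` and every `v ∈ S`, on the twin frame**
(`K` imaginary quadratic Heegner for `N`, `κ` anticyclotomic, MULTIPLICATIVE reduction of `W_K` above `3`; `S ⊆ {v ∣ 3N}`, `⊇ {v ∣ 3}`,
`Aut(K/ℚ)`-stable): for `m ≫ 0`, `(θ_v ∘ transport_v)(F̄_k(σ v)) = F̄_k(v)` — x10b's letter `Stmt.h5bAtS` at `p = 3`.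
[cite: Howard2004HeegnerKolyvagin, §1.3 H.5(b) (arXiv:1202.6340 p. 7 L96–97), §1.6, §2.2] [cite: Brink2007, Thm. 2 and Cor. 1] -/
theorem h5bAtThree_of_hasMultiplicativeReductionAt :
  ∀ (N : ℕ) [NeZero N] (W : WeierstrassCurve ℚ) [W.IsElliptic] (K : Type) [Field K] [NumberField K]
    (κ : ZpExtension K 3),
    IsImaginaryQuadratic K → κ.IsAnticyclotomic → SatisfiesHeegnerHypothesis N K →
    (∀ w : HeightOneSpectrum (𝓞 K), ((3 : ℕ) : 𝓞 K) ∈ w.asIdeal → (W.baseChange K).HasMultiplicativeReductionAt w) →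
    ∀ (S : Finset (HeightOneSpectrum (𝓞 K)))
      (hpS : ∀ v, ((3 : ℕ) : 𝓞 K) ∈ v.asIdeal → v ∈ S)
      (hbad : ∀ v, v ∉ S → ((3 : ℕ) : 𝓞 K) ∉ v.asIdeal → (W.baseChange K).HasGoodReductionAt v),
    (∀ v ∈ S, ((3 : ℕ) : 𝓞 K) ∈ v.asIdeal ∨ ((N : ℕ) : 𝓞 K) ∈ v.asIdeal) →
    (∀ (σ : K ≃ₐ[ℚ] K) (v : HeightOneSpectrum (𝓞 K)), σ • v ∈ S → v ∈ S) →
    ∃ m₅ : ℕ, ∀ (m : ℕ) (hm : 1 ≤ m), m₅ ≤ m →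
      letI := IwasawaAlgebra.isDomain_quotient_X_pow_add_C 3 hm
      letI := IwasawaAlgebra.isDiscreteValuationRing_quotient_X_pow_add_C 3 hm
      haveI := IwasawaAlgebra.EisensteinCoeff.isLocalRing_succ 3 hm
      letI := IwasawaAlgebra.EisensteinCoeff.algebraOfSpecSucc 3 m
      haveI := W.isScalarTower_algebraOfSpecSucc (K := K) (p := 3) (m := m)
      letI := W.residueModuleSucc (K := K) (p := 3) hm
      ∀ (π : ∀ v : HeightOneSpectrum (𝓞 K), TamePin v) (L : Set (HeightOneSpectrum (𝓞 K)))
        (hL : L ⊆ (W.eisensteinTower (κ.unitTwist (-1)) hm).degreeTwoPrimes 3) (hLS : ∀ v ∈ L, v ∉ S)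
        (jbar' : AlgebraicClosure K →+* ℂ)
        (c₀ : absoluteGaloisGroup ℚ) (σ : K ≃ₐ[ℚ] K) (hσ₁ : σ ≠ 1) (hσ : σ * σ = 1)
        (hτl : IsLiftOfAut σ (absGaloisTransport (K := ℚ) (L := K) c₀).toRingEquiv)
        (hτ₂ : Function.Involutive (absGaloisTransport (K := ℚ) (L := K) c₀).toRingEquiv)
        (D : ∀ k, DualityDatum 3 (ConjugationDatum.ofLifts σ hσ₁ hσ _ hτl hτ₂)
          ((W.eisensteinTower (κ.unitTwist (-1)) hm).ρ k) (IwasawaAlgebra.EisensteinCoeff 3 m (k + 1)))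
        (e : ∀ j : ℕ, geomTorsion (W.baseChange K) (((3 : ℕ) : ℤ) ^ j) →+ geomTorsion (W.baseChange K) (((3 : ℕ) : ℤ) ^ j) →+
          MuCarrier K (3 ^ j))
        (log : ∀ j : ℕ, MuCarrier K (3 ^ j) →+ ZMod (3 ^ j)),
        IsComplexConjugation (Rat.castHom ℝ) c₀ →
        (∀ x, (ConjugationDatum.ofLifts σ hσ₁ hσ _ hτl hτ₂).τ x = absGaloisTransport (K := ℚ) (L := K) c₀ x) →
        (∀ k, (D k).e = ZpExtension.eisensteinDualityForm hm (k + 1)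
          (conjPairing (e (k + 1)) ((ConjugationDatum.ofLifts σ hσ₁ hσ _ hτl hτ₂).isLift.torsionMap W _)
            (log (k + 1)))) →
        (∀ j a, e j a a = 0) →
        (∀ j (g : absoluteGaloisGroup K) a b, e j (g • a) (g • b) = mu K (3 ^ j) g (e j a b)) →
        (∀ j a b, e j ((ConjugationDatum.ofLifts σ hσ₁ hσ _ hτl hτ₂).isLift.torsionMap W _ a)
          ((ConjugationDatum.ofLifts σ hσ₁ hσ _ hτl hτ₂).isLift.torsionMap W _ b) = -e j a b) →
        (∀ j (a : geomTorsion (W.baseChange K) (((3 : ℕ) : ℤ) ^ j)),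
          (ConjugationDatum.ofLifts σ hσ₁ hσ _ hτl hτ₂).isLift.torsionMap W _
            ((ConjugationDatum.ofLifts σ hσ₁ hσ _ hτl hτ₂).isLift.torsionMap W _ a) = a) →
        (∀ j, Function.Bijective (log j)) →
        (∀ j (g : absoluteGaloisGroup K) ξ, log j (mu K (3 ^ j) g ξ) = cyclotomicCharacterModPow K 3 j g * log j ξ) →
        ∀ k, ∀ v ∈ S,
          (((W.isQuotientBy_eisensteinDVRSetting_πbar (κ.unitTwist (-1)) hm S hpS hbad L hL hLS jbar'
              (ConjugationDatum.ofLifts σ hσ₁ hσ _ hτl hτ₂) D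
              (W.eisensteinLevelsTameFs (κ.unitTwist (-1)) hm π S hpS hbad L hL hLS)
              k).propagateStructure (W.eisensteinTowerTriple (κ.unitTwist (-1)) hm S hpS hbad L hL hLS k).cond)
              (Sum.inr (σ • v))).map
              (((W.residualTauGeomTorsion (p := 3) (ConjugationDatum.ofLifts σ hσ₁ hσ _ hτl hτ₂) hm (k := k + 1)
                  k.succ_pos).thetaH1 (Sum.inr v)).comp
                ((ConjugationDatum.ofLifts σ hσ₁ hσ _ hτl hτ₂).transportH1
                  ((W.baseChange K).torsionGaloisModule ((3 : ℕ) : ℤ)) v)) =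
            ((W.isQuotientBy_eisensteinDVRSetting_πbar (κ.unitTwist (-1)) hm S hpS hbad L hL hLS jbar'
              (ConjugationDatum.ofLifts σ hσ₁ hσ _ hτl hτ₂) D
              (W.eisensteinLevelsTameFs (κ.unitTwist (-1)) hm π S hpS hbad L hL hLS)
              k).propagateStructure (W.eisensteinTowerTriple (κ.unitTwist (-1)) hm S hpS hbad L hL hLS k).cond)
              (Sum.inr v) := by
  intro N _ W _ K _ _ κ hK hanti₀ hHeeg hmultw S hpS hbad hSN hSσ
  haveI : IsTotallyComplex K := hK.isTotallyComplex
  classical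
  -- `κ⁻ = κ.unitTwist (-1)` is anticyclotomic; the places of `S` prime to `p` lie over `N`, hence are finitely decomposed
  have hantiκ : (κ.unitTwist (-1)).IsAnticyclotomic := hanti₀.unitTwist (-1)
  have hdec : ∀ v ∈ S, ((3 : ℕ) : 𝓞 K) ∉ v.asIdeal → ¬ (GreenbergSelmer.decomp v ≤ (κ.unitTwist (-1)).kerSubgroup) :=
    fun v hvS hpv ↦ ZpExtension.not_decomp_le_kerSubgroup_of_natCast_mem (κ.unitTwist (-1)) hK hantiκ hHeeg
      ((hSN v hvS).resolve_left hpv) hpv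
  -- ONE threshold for the places prime to `p` (all conjugation data, all H.4 data, all slots)
  obtain ⟨m₁, hm₁⟩ :=
    W.eisensteinDVRSetting_exists_forall_h5b_clause_zero_of_not_mem (κ.unitTwist (-1)) S hpS hbad hdec
  -- the thresholds of the hypothesis at the places above `p`
  have hP := UniversalToricDescentTwinH5bAtSZeroThree.h5bAtSZeroThree_of_hasMultiplicativeReductionAt N W K κ hK hanti₀ hHeeg
    hmultw S hpS hbad hSN hSσ
  choose! mP hmP using hP
  refine ⟨max m₁ (S.sup mP) + 1, fun m hm hle ↦ ?_⟩
  letI := IwasawaAlgebra.isDomain_quotient_X_pow_add_C 3 hm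
  letI := IwasawaAlgebra.isDiscreteValuationRing_quotient_X_pow_add_C 3 hm
  haveI := IwasawaAlgebra.EisensteinCoeff.isLocalRing_succ 3 hm
  letI := IwasawaAlgebra.EisensteinCoeff.algebraOfSpecSucc 3 m
  haveI := W.isScalarTower_algebraOfSpecSucc (K := K) (p := 3) (m := m)
  letI := W.residueModuleSucc (K := K) (p := 3) hm
  intro π L hL hLS jbar' c₀ σ hσ₁ hσ hτl hτ₂ D e log hc₀ hτ hDe h4' h5' h6' h7' h8' h9'
  have hm₁m : m₁ < m := by omega
  -- every level `k` from level `0`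
  refine W.eisensteinDVRSetting_h5b_hfin_of_zero (κ.unitTwist (-1)) hm S hpS hbad L hL hLS jbar' σ hσ₁ hσ _ hτl hτ₂ D
    (W.eisensteinLevelsTameFs (κ.unitTwist (-1)) hm π S hpS hbad L hL hLS) (fun v hvS ↦ ?_)
  by_cases hpv : ((3 : ℕ) : 𝓞 K) ∈ v.asIdeal
  · -- above `p`: the hypothesis
    have hmPv : mP v < m := lt_of_le_of_lt (Finset.le_sup (f := mP) hvS) (by omega)
    exact hmP v hvS hpv m hm hmPv π L hL hLS jbar' c₀ σ hσ₁ hσ hτl hτ₂ D e log hc₀ hτ hDe h4' h5' h6' h7' h8' h9'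
  · -- prime to `p`: the uniform A4 clause on the frame
    have hanti : ∀ g : absoluteGaloisGroup K,
        ((κ.unitTwist (-1)) ((ConjugationDatum.ofLifts σ hσ₁ hσ _ hτl hτ₂).conj g)).toAdd =
          -((κ.unitTwist (-1)) g).toAdd :=
      fun g ↦ ZpExtension.toAdd_conjGalCMH_eq_neg (κ.unitTwist (-1)) hantiκ (fun w ↦ IsTotallyComplex.isComplex w)
        (ConjugationDatum.ofLifts σ hσ₁ hσ _ hτl hτ₂).isLift hc₀ hτ g
    have hSσ' : ∀ w ∈ S, (ConjugationDatum.ofLifts σ hσ₁ hσ _ hτl hτ₂).σ • w ∈ S := fun w hw ↦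
      hSσ σ _ (by change σ • σ • w ∈ S; rwa [smul_smul, hσ, one_smul])
    exact hm₁ m hm hm₁m L hL hLS jbar' (ConjugationDatum.ofLifts σ hσ₁ hσ _ hτl hτ₂) D
      (W.eisensteinLevelsTameFs (κ.unitTwist (-1)) hm π S hpS hbad L hL hLS) hanti hSσ' v hvS hpv

end Summit.BirchSwinnertonDyer.BirchSwinnertonDyer.Theorems.UniversalToricDescentTwinH5bAtSThree

end
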